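import Literature.AnabelianGeometry.SemiGraphs.HomRestrict
import Literature.AnabelianGeometry.SemiGraphs.CoveringHomCanonical
import Literature.AnabelianGeometry.SemiGraphs.PreimageComponentLemmas

/-!
# The covering `𝒢_A|_{φ⁻¹ℍ} → 𝒢|_ℍ` is the covering of `𝒢|_ℍ` attached to `A|_ℍ` — relabelling

Mochizuki, *Semi-graphs of anabelioids*, Publ. RIMS **42** (2006), §2 p. 23 (Def. 2.2 (i): the covering
`𝒢′ → 𝒢` attached to `A ∈ B(𝒢)`) and p. 30, proof of Cor. 2.7 (i): "a connected finite Galois étale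
covering `𝒢′ → 𝒢` — whose restriction to `ℍ` … we denote by `ℋ′ → ℍ`"
[cite: MochizukiSemiAnbd2006, Cor. 2.7(i) p.30].  abc-iut cell, layer L3, row «D3b (CORE)»
(abc-iut-w4-d071), RELABEL step.  PROOF-ONLY file (no `def`).

For the CONSTRUCTED covering `φ := A.coveringHomCan : 𝒢_A → 𝒢` (abc-iut-L3-t5, `CoveringHomCanonical.lean`)
and a sub-semi-graph `ℍ ⊆ 𝔾`, write `K̄ := φ⁻¹ℍ ⊆ 𝔾_A` (whole preimage) and `ψ̄ := φ|_{K̄} : 𝒢_A|_{K̄} → 𝒢|_ℍ`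
(abc-iut-L6-t17's `Hom.restrict`).  On the other hand `A|_ℍ := (−)|_ℍ A` is an object of `B(𝒢|_ℍ)` and
t5's construction applied to `(𝒢|_ℍ, A|_ℍ)` yields the covering `č := (A|_ℍ).coveringHomCan : (𝒢|_ℍ)_{A|_ℍ} → 𝒢|_ℍ`.
The two semi-graphs of anabelioids `𝒢_A|_{K̄}` and `(𝒢|_ℍ)_{A|_ℍ}` differ only by a RELABELLING of their
index types (vertices `⟨⟨v, P⟩, v ∈ ℍ⟩` versus `⟨⟨v, v ∈ ℍ⟩, P⟩`, etc.): their constituents, gluing functors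
and the constituents / 2-cells of `ψ̄`, `č` agree DEFINITIONALLY.  This file records the consequence the
Cor. 2.7 (i) programme needs: at a base vertex `x` of `K̄` with basepoints `F′`, `F`, `e`, the homomorphisms
`ι_{ψ̄} : Π_{K̄} → Π_ℍ` and `ι_č : Π_{(𝒢|ℍ)_{A|ℍ}} → Π_ℍ` (the `ι` of the dictionary item (D1), abc-iut-L3-d3's
`FiniteEtaleCoveringDictionary.lean`) have THE SAME RANGE (`range_ι_restrict_preimage_eq`): the relabelling
functors `B((𝒢|_ℍ)_{A|_ℍ}) ⇄ B(𝒢_A|_{K̄})` (constructed inside the proof) intertwine `č^*` with `ψ̄^*` on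
objects and the basepoints on the nose.  Honest framing: pure bookkeeping; nothing here bears on
[IUTchIII] Cor. 3.12.
-/

namespace Literature.AnabelianGeometry.SemiGraphs

open CategoryTheory CategoryTheory.Limits CategoryTheory.PreGaloisCategory
open Literature.AnabelianGeometry.Anabelioids

universe v₁ u₁ u

namespace SemiGraphOfAnabelioids

namespace BObj

variable {𝒢 : SemiGraphOfAnabelioids.{v₁, u₁, u}} (A : 𝒢.BObj) (H : 𝒢.graph.Subgraph)

/-! ### Abutments: `𝔾_A` versus the total graph of `A|_ℍ` over `ℍ` -/

/-- A branch `(b, c)` of `𝔾_A` abuts to `(v, d)` iff `b` abuts to `v` in `𝔾` and `d` is the component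
under `c`. [cite: MochizukiSemiAnbd2006, Def. 2.2(i) p.23] -/
theorem total_abuts_mk_eq_some_iff {G : SemiGraph.{u}} (D : G.FibreData) (b : G.Branch)
    (c : D.FE (G.edgeOf b)) (v : G.Vertex) (d : D.FV v) :
    D.total.abuts ⟨b, c⟩ = some ⟨v, d⟩ ↔ ∃ h : G.abuts b = some v, D.σ b v h c = d := by
  change (G.abuts b).pbind _ = _ ↔ _
  constructor
  · intro h
    obtain ⟨w, hw, h⟩ := Option.pbind_eq_some_iff.mp h
    obtain ⟨rfl, hd⟩ := Sigma.mk.inj_iff.mp (Option.some.inj h)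
    exact ⟨Option.mem_def.mp hw, eq_of_heq hd⟩
  · rintro ⟨h, rfl⟩
    exact Option.pbind_eq_some_iff.mpr ⟨v, Option.mem_def.mpr h, rfl⟩

/-- Abutment in the preimage sub-semi-graph `K̄ = φ⁻¹ℍ ⊆ 𝔾_A` implies abutment of the relabelled branch in
the total graph of `A|_ℍ` over `ℍ`. [cite: MochizukiSemiAnbd2006, Def. 2.2(i) p.23] -/
theorem restrictFunctor_total_abuts_of_preimage_abuts
    (b : (⟨A.coveringHomCan.base.vertexMap ⁻¹' H.verts, A.coveringHomCan.base.edgeMap ⁻¹' H.edges⟩ :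
      A.coveringGraph.graph.Subgraph).toSemiGraph.Branch)
    (y : (⟨A.coveringHomCan.base.vertexMap ⁻¹' H.verts, A.coveringHomCan.base.edgeMap ⁻¹' H.edges⟩ :
      A.coveringGraph.graph.Subgraph).toSemiGraph.Vertex)
    (h : (⟨A.coveringHomCan.base.vertexMap ⁻¹' H.verts, A.coveringHomCan.base.edgeMap ⁻¹' H.edges⟩ :
      A.coveringGraph.graph.Subgraph).toSemiGraph.abuts b = some y) :
    ((𝒢.restrictFunctor H).obj A).fibreData.total.abuts ⟨⟨b.1.1, b.2⟩, b.1.2⟩ =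
      some ⟨⟨y.1.1, y.2⟩, y.1.2⟩ := by
  have h1 : A.fibreData.total.abuts ⟨b.1.1, b.1.2⟩ = some ⟨y.1.1, y.1.2⟩ :=
    (SemiGraph.Subgraph.ι _).abuts_branchMap b y h
  obtain ⟨h0, hd⟩ := (total_abuts_mk_eq_some_iff A.fibreData b.1.1 b.1.2 y.1.1 y.1.2).mp h1
  have hH : H.toSemiGraph.abuts ⟨b.1.1, b.2⟩ = some ⟨y.1.1, y.2⟩ :=
    H.toSemiGraph_abuts_of_mem b.2 h0 y.2
  exact (total_abuts_mk_eq_some_iff ((𝒢.restrictFunctor H).obj A).fibreData ⟨b.1.1, b.2⟩ b.1.2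
    ⟨y.1.1, y.2⟩ y.1.2).mpr ⟨hH, hd⟩

/-- Conversely, abutment in the total graph of `A|_ℍ` over `ℍ` implies abutment of the relabelled branch in
the preimage sub-semi-graph `K̄ = φ⁻¹ℍ ⊆ 𝔾_A`. [cite: MochizukiSemiAnbd2006, Def. 2.2(i) p.23] -/
theorem preimage_abuts_of_restrictFunctor_total_abuts
    (b : ((𝒢.restrictFunctor H).obj A).fibreData.total.Branch)
    (z : ((𝒢.restrictFunctor H).obj A).fibreData.total.Vertex)
    (h : ((𝒢.restrictFunctor H).obj A).fibreData.total.abuts b = some z) :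
    (⟨A.coveringHomCan.base.vertexMap ⁻¹' H.verts, A.coveringHomCan.base.edgeMap ⁻¹' H.edges⟩ :
      A.coveringGraph.graph.Subgraph).toSemiGraph.abuts ⟨⟨b.1.1, b.2⟩, b.1.2⟩ =
      some ⟨⟨z.1.1, z.2⟩, z.1.2⟩ := by
  have h' : ((𝒢.restrictFunctor H).obj A).fibreData.total.abuts ⟨b.1, b.2⟩ = some ⟨z.1, z.2⟩ := h
  obtain ⟨hH, hd⟩ :=
    (total_abuts_mk_eq_some_iff ((𝒢.restrictFunctor H).obj A).fibreData b.1 b.2 z.1 z.2).mp h'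
  have h0 : 𝒢.graph.abuts b.1.1 = some z.1.1 := H.ι.abuts_branchMap b.1 z.1 hH
  have h1 : A.fibreData.total.abuts ⟨b.1.1, b.2⟩ = some ⟨z.1.1, z.2⟩ :=
    (total_abuts_mk_eq_some_iff A.fibreData b.1.1 b.2 z.1.1 z.2).mpr ⟨h0, hd⟩
  exact SemiGraph.Subgraph.toSemiGraph_abuts_of_mem
    (⟨A.coveringHomCan.base.vertexMap ⁻¹' H.verts, A.coveringHomCan.base.edgeMap ⁻¹' H.edges⟩ :
      A.coveringGraph.graph.Subgraph) (b := ⟨b.1.1, b.2⟩) b.1.2 h1 z.1.2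

end BObj

variable {𝒢 : SemiGraphOfAnabelioids.{v₁, u₁, u}}

/-! ### The ranges of `ι_{ψ̄}` and `ι_č` agree -/

/-- **Relabelling: `ι_{ψ̄}` and `ι_č` have the same range.**  For `A ∈ B(𝒢)`, `ℍ ⊆ 𝔾`, the preimage
`K̄ := φ⁻¹ℍ` under `φ := A.coveringHomCan`, the restriction `ψ̄ := φ|_{K̄} : 𝒢_A|_{K̄} → 𝒢|_ℍ`, the covering
`č : (𝒢|_ℍ)_{A|_ℍ} → 𝒢|_ℍ` of `𝒢|_ℍ` attached to `A|_ℍ`, a base vertex `x = ⟨(v, P), _⟩` of `K̄` (relabelled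
`x″ = ⟨⟨v, _⟩, P⟩`), and basepoints `F′` of the common constituent `(𝒢_v)_P`, `F` of `𝒢_v`,
`e : φ_{(v,P)}^* ⋙ F′ ≅ F`: the images of `Π_{K̄} → Π_ℍ` (along `ψ̄`) and of `Π_{(𝒢|ℍ)_{A|ℍ}} → Π_ℍ` (along `č`)
coincide — the relabelling functors `B((𝒢|_ℍ)_{A|_ℍ}) ⇄ B(𝒢_A|_{K̄})` intertwine `č^*` and `ψ̄^*` on objects.
[cite: MochizukiSemiAnbd2006, Cor. 2.7(i) p.30] -/
theorem range_ι_restrict_preimage_eq (A : 𝒢.BObj) (H : 𝒢.graph.Subgraph)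
    (x : (⟨A.coveringHomCan.base.vertexMap ⁻¹' H.verts, A.coveringHomCan.base.edgeMap ⁻¹' H.edges⟩ :
      A.coveringGraph.graph.Subgraph).toSemiGraph.Vertex)
    (F' : A.coveringGraph.V x.1 ⥤ FintypeCat.{v₁})
    (F : 𝒢.V (A.coveringHomCan.base.vertexMap x.1) ⥤ FintypeCat.{v₁})
    (e : (A.coveringHomCan.φV x.1).pullback ⋙ F' ≅ F) :
    let K : A.coveringGraph.graph.Subgraph :=
      ⟨A.coveringHomCan.base.vertexMap ⁻¹' H.verts, A.coveringHomCan.base.edgeMap ⁻¹' H.edges⟩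
    let ψ : Hom (A.coveringGraph.restrict K) (𝒢.restrict H) :=
      A.coveringHomCan.restrict K H (fun _ h => h) (fun _ h => h)
    let v : H.toSemiGraph.Vertex := ⟨A.coveringHomCan.base.vertexMap x.1, x.2⟩
    let ιψ : (A.coveringGraph.restrict K).Pi x F' →* (𝒢.restrict H).Pi v F :=
      (Aut.autMulEquivOfIso (Functor.isoWhiskerLeft ((𝒢.restrict H).ρ v) e)).toMonoidHom.comp
        (pi1Map ψ.pullbackFunctor ((A.coveringGraph.restrict K).ρ x ⋙ F'))
    let Aℍ : (𝒢.restrict H).BObj := (𝒢.restrictFunctor H).obj A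
    let x'' : Aℍ.coveringGraph.graph.Vertex := ⟨v, x.1.2⟩
    let ιc : Aℍ.coveringGraph.Pi x'' F' →* (𝒢.restrict H).Pi v F :=
      (Aut.autMulEquivOfIso (Functor.isoWhiskerLeft ((𝒢.restrict H).ρ v) e)).toMonoidHom.comp
        (pi1Map Aℍ.coveringHomCan.pullbackFunctor (Aℍ.coveringGraph.ρ x'' ⋙ F'))
    ιψ.range = ιc.range := by
  intro K ψ v ιψ Aℍ x'' ιc
  -- the relabelling functors
  let R₁ : Aℍ.coveringGraph.BObj ⥤ (A.coveringGraph.restrict K).BObj :=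
    { obj := fun X =>
        { S := fun y => X.S ⟨⟨y.1.1, y.2⟩, y.1.2⟩
          T := fun y => X.T ⟨⟨y.1.1, y.2⟩, y.1.2⟩
          ψ := fun b y h => X.ψ ⟨⟨b.1.1, b.2⟩, b.1.2⟩ ⟨⟨y.1.1, y.2⟩, y.1.2⟩
            (BObj.restrictFunctor_total_abuts_of_preimage_abuts A H b y h) }
      map := fun f =>
        { fS := fun y => f.fS ⟨⟨y.1.1, y.2⟩, y.1.2⟩
          fT := fun y => f.fT ⟨⟨y.1.1, y.2⟩, y.1.2⟩
          comm := fun b y h => f.comm ⟨⟨b.1.1, b.2⟩, b.1.2⟩ ⟨⟨y.1.1, y.2⟩, y.1.2⟩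
            (BObj.restrictFunctor_total_abuts_of_preimage_abuts A H b y h) }
      map_id := fun X => rfl
      map_comp := fun f g => rfl }
  let R₂ : (A.coveringGraph.restrict K).BObj ⥤ Aℍ.coveringGraph.BObj :=
    { obj := fun Y =>
        { S := fun z => Y.S ⟨⟨z.1.1, z.2⟩, z.1.2⟩
          T := fun z => Y.T ⟨⟨z.1.1, z.2⟩, z.1.2⟩
          ψ := fun b z h => Y.ψ ⟨⟨b.1.1, b.2⟩, b.1.2⟩ ⟨⟨z.1.1, z.2⟩, z.1.2⟩
            (BObj.preimage_abuts_of_restrictFunctor_total_abuts A H b z h) }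
      map := fun f =>
        { fS := fun z => f.fS ⟨⟨z.1.1, z.2⟩, z.1.2⟩
          fT := fun z => f.fT ⟨⟨z.1.1, z.2⟩, z.1.2⟩
          comm := fun b z h => f.comm ⟨⟨b.1.1, b.2⟩, b.1.2⟩ ⟨⟨z.1.1, z.2⟩, z.1.2⟩
            (BObj.preimage_abuts_of_restrictFunctor_total_abuts A H b z h) }
      map_id := fun Y => rfl
      map_comp := fun f g => rfl }
  -- they intertwine the pull-back functors on objects
  have hobj₁ : ∀ X : (𝒢.restrict H).BObj,
      ψ.pullbackFunctor.obj X = R₁.obj (Aℍ.coveringHomCan.pullbackFunctor.obj X) := by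
    intro X
    change SemiGraphOfAnabelioids.BObj.mk _ _ _ = SemiGraphOfAnabelioids.BObj.mk _ _ _
    congr 1
  have hobj₂ : ∀ X : (𝒢.restrict H).BObj,
      R₂.obj (ψ.pullbackFunctor.obj X) = Aℍ.coveringHomCan.pullbackFunctor.obj X := by
    intro X
    change SemiGraphOfAnabelioids.BObj.mk _ _ _ = SemiGraphOfAnabelioids.BObj.mk _ _ _
    congr 1
  apply le_antisymm
  · rintro _ ⟨σ, rfl⟩
    refine ⟨pi1Map R₁ ((A.coveringGraph.restrict K).ρ x ⋙ F') σ, ?_⟩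
    refine Iso.ext (NatTrans.ext (funext fun X => ?_))
    have key : σ.hom.app (ψ.pullbackFunctor.obj X) =
        σ.hom.app (R₁.obj (Aℍ.coveringHomCan.pullbackFunctor.obj X)) :=
      eq_of_heq (congr_arg_heq (fun Y => σ.hom.app Y) (hobj₁ X))
    change e.inv.app _ ≫ σ.hom.app (R₁.obj (Aℍ.coveringHomCan.pullbackFunctor.obj X)) ≫ e.hom.app _ =
      e.inv.app _ ≫ σ.hom.app (ψ.pullbackFunctor.obj X) ≫ e.hom.app _
    rw [key]
    rfl
  · rintro _ ⟨τ, rfl⟩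
    refine ⟨pi1Map R₂ (Aℍ.coveringGraph.ρ x'' ⋙ F') τ, ?_⟩
    refine Iso.ext (NatTrans.ext (funext fun X => ?_))
    have key : τ.hom.app (R₂.obj (ψ.pullbackFunctor.obj X)) =
        τ.hom.app (Aℍ.coveringHomCan.pullbackFunctor.obj X) :=
      eq_of_heq (congr_arg_heq (fun Y => τ.hom.app Y) (hobj₂ X))
    change e.inv.app _ ≫ τ.hom.app (R₂.obj (ψ.pullbackFunctor.obj X)) ≫ e.hom.app _ =
      e.inv.app _ ≫ τ.hom.app (Aℍ.coveringHomCan.pullbackFunctor.obj X) ≫ e.hom.app _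
    rw [key]
    rfl

end SemiGraphOfAnabelioids

end Literature.AnabelianGeometry.SemiGraphs
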